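import Literature.Analysis.OperatorTheory.Enflo2023.CaseIIFactor
import Literature.Analysis.OperatorTheory.Enflo2023.Lemma2
import HarnessLib

/-!
# Enflo (2023), Part A p.13: two consecutive (exact) Case II stages are RIGID — the minimal move is the scaling

Source under adjudication: Per H. Enflo, *On the invariant subspace problem in Hilbert spaces*, arXiv:2305.15442
(v2, 2024), bib key `Enflo2023`.  [cite: Enflo2023, v2 p.12 (Case I / Case II), p.13, eq. (26)–(27) and tex
L429: "Thus, every time we apply Lemma 2 we either get Case I and we are done, or we get Case II and pass to a
smaller `εθ`, diminished by a factor `(1 − 1/20)` … So, if Case II happens every time we obtain convergence to a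
non-cyclic vector."; tex L444–L446 (Remark): "We can think of Case II happening every time as a singular
situation … `ℓ_{1δ}(T)` will just be near to `ℓ(T) + 2δI`".]  Part of the b2b-enflo repair cell's kernel-tight
typing of the manuscript (formaliser 1, Part A).  NOTHING here asserts the manuscript's main theorem; no
declaration concludes the invariant subspace problem for an arbitrary operator.  Value (BLOCK-2b): theorems /
refutations of typed inferences about a text.

`CaseIIFactor.lean` computed the factor by which `εθ` contracts under THE minimal solution `a` of (26)
(`IsMinimal V_y x₀ ‖x₀ − (1+δ)y‖ a`, `δ = εθ/10`) at ONE Case II stage and showed that "diminished by a factor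
`(1 − 1/20)`" FAILS there when `y` is aligned with `Ty` deep in a run (`CaseII.factor_false_for_minimal`, model
`CaseII.FactorModel`).  The text, however, USES the factor only on the branch "Case II happens every time", i.e.
when the NEXT stage `y' := ℓ'(T)y = V_y a` is again Case II.  This file types that situation, Case II read
exactly (`⟨x₀ − y, T^j y⟩ = 0` and `⟨x₀ − y', T^j y'⟩ = 0` for all `j ≥ 1`), and finds it RIGID:

* PURE KKT (`CaseII.inner_next_orbit_eq`): `⟨x₀ − y', T^j y'⟩ = C'·⟪a, S^j a⟫_{ℓ²}` for every `j` — Case II at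
  the next stage is the vanishing of the AUTOCORRELATION of the coefficient sequence `a` at all lags `j ≥ 1`.
* RIGIDITY (`CaseII.L_eq_zero_of_consecutive_caseII`, `CaseII.consecutive_caseII_rigidity`; `‖T‖² ≤ 1/2`,
  `‖x₀‖ = 1`, `⟨x₀ − y, y⟩ = εθ > 0`): exact Case II at `y` AND at `y'` forces `L a = 0`, i.e.
  `ℓ'(T) = a₀·I`; then activity forces `a₀ = 1 + δ` EXACTLY, `y' = (1+δ)y`, the Lagrange identities force
  `⟨T^j y, y⟩ = 0` for all `j ≥ 1`, and `(εθ)' = (1+δ)(1 − ‖y‖²/10)·εθ`.  (Proof, coordinate-free: with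
  `w := y' − y`, `w₁ := y' − a₀y = T V_y(La)`, (5) and Case II at `y` give `⟨w, w₁⟩ = −C'‖La‖²`; Case II at `y'`
  tested against `Σ_{j≥1} a_j T^j y' = w₁ + T V_w(La)` gives `⟨w, T V_w(La)⟩ = C'‖La‖²`; splitting
  `V_w = (a₀−1)V_y + V_{w₁}` leaves `⟨w, T V_{w₁}(La)⟩ = C'a₀‖La‖²`, whose modulus is at most
  `‖w‖·‖T‖²(1−‖T‖²)⁻¹‖y‖·‖La‖² ≤ (εθ/10)‖y‖²‖La‖²` while `C'·Re a₀ = εθ − Re⟨y, w⟩ ≥ εθ(1 − ‖y‖²/10)`.)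
* CONSEQUENCES.  (i) `CaseII.factor_of_consecutive_caseII`: in the text's window (`‖x₀ − y‖ ≤ 0.7`,
  `εθ ≤ 10⁻⁴`) the factor HOLDS at every Case II stage that is followed by a Case II stage:
  `(εθ)' ≤ 0.9491·εθ < (1 − 1/20)εθ`.  (ii) `CaseII.next_not_caseII_of_factor_fails`: where the factor fails
  (e.g. `CaseII.factor_false_for_minimal`), the next stage is NOT (exact) Case II — the failure of
  `CaseIIFactor.lean` is a one-stage phenomenon.  (iii) `CaseII.hasNontrivialClosedInvariantSubspace_of_consecutive_caseII`:
  two consecutive exact Case II stages from the window `0.3 ≤ ‖x₀ − y‖ ≤ 0.7` already give a non-trivial closed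
  invariant subspace (`y` itself is non-cyclic: `x₀ − (1 + εθ/‖y‖²)y ⟂ T^j y` for all `j ≥ 0`) — no
  convergence argument is needed, and "Case II happens every time" is exactly the scaling ray `y_n = c_n y₀`.

So, read exactly, the sentence at tex L429 is TRUE on the all-Case-II branch
(`CaseII.hasNontrivialClosedInvariantSubspace_of_exact_caseII_along_runs`: no contraction hypothesis, compare
`CaseII.hasNontrivialClosedInvariantSubspace_of_contraction_along_runs`) although its stated reason ((27), refuted
in `CaseII.lean`) and the single-stage factor (refuted in `CaseIIFactor.lean`) are not.  The text's Case II is the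
APPROXIMATE condition `|⟨T^j y, x₀ − y⟩| < (εθ)⁴` (tex L400); the quantitative counterpart of this rigidity under
that condition (error terms relative to `εθ`) is NOT in this file (packet `REPAIR-CENSUS.md`, row F1-V9).
Origin: planner-b2b-enflo-1-g7-0 (F1 gen-7), 2026-08-18.
-/

noncomputable section

open scoped InnerProductSpace ENNReal
open Literature.Analysis.UnboundedOperators (inner_self_eq_coe_norm_sq)

namespace Literature.Analysis.OperatorTheory.Enflo2023

variable {H : Type*} [NormedAddCommGroup H] [InnerProductSpace ℂ H] [CompleteSpace H]

namespace Vy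

/-! ### Shifts, and the vector `S(La) = a − a₀e₀` (base-vector linearity `V_add_vec`/`V_smul_vec` is in `Lemma2.lean`) -/

/-- `V_y (S^k c) = T^k (V_y c)` (the intertwining `V_shift`, iterated). [cite: Enflo2023, v2 p.4, eq. (9)] -/
theorem V_shift_pow (T : H →L[ℂ] H) (hT : ‖T‖ < 1) (y : H) (k : ℕ) (c : ℓ2) :
    V T hT y ((S ^ k) c) = (T ^ k) (V T hT y c) :=
  IsMinimal.intertwine_pow (V := V T hT y) S T (V_shift T hT y) k c

/-- `(S^{k+1} c)₀ = 0`. [folklore] -/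
theorem S_pow_succ_apply_zero (k : ℕ) (c : ℓ2) : ((S ^ (k + 1)) c) 0 = 0 := by
  rw [pow_succ', mul_apply_eq_comp]; exact S_apply_zero _

/-- `S(La) = a − a₀e₀`: shifting the tail back leaves `a` without its head. [folklore] -/
theorem S_L_eq (a : ℓ2) : S (L a) = a - a 0 • (lp.single 2 0 (1 : ℂ) : ℓ2) := by
  refine lp.ext (funext fun j => ?_)
  cases j with
  | zero => simp [lp.single_apply]
  | succ j => simp [lp.single_apply]

/-- `⟪a, S(La)⟫ = ‖La‖²` (`= ‖a‖² − |a₀|²`). [folklore] -/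
theorem inner_S_L (a : ℓ2) : ⟪a, S (L a)⟫_ℂ = ((‖L a‖ ^ 2 : ℝ) : ℂ) := by
  rw [S_L_eq, inner_sub_right, inner_smul_right, lp.inner_single_right, inner_self_eq_coe_norm_sq,
    norm_L_apply_sq]
  have h : a 0 * ⟪a 0, (1 : ℂ)⟫_ℂ = ((‖a 0‖ ^ 2 : ℝ) : ℂ) := by
    rw [RCLike.inner_apply, one_mul, Complex.mul_conj, Complex.normSq_eq_norm_sq]
  rw [h]; push_cast; ring

/-- If `x ⟂ T^{j+1} z` for every `j ≥ 0` then `x ⟂ T(V_z c)` for every `c ∈ ℓ²` (the series form of `V_z`). [folklore] -/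
theorem inner_T_V_eq_zero (T : H →L[ℂ] H) (hT : ‖T‖ < 1) (x z : H)
    (h : ∀ j : ℕ, ⟪x, (T ^ (j + 1)) z⟫_ℂ = 0) (c : ℓ2) : ⟪x, T (V T hT z c)⟫_ℂ = 0 := by
  rw [← V_shift, ← inner_conj_symm, inner_V_left]
  have h' : ∀ j, (starRingEnd ℂ) ((S c) j) * ⟪(T ^ j) z, x⟫_ℂ = 0 := by
    intro j
    cases j with
    | zero => rw [S_apply_zero, map_zero, zero_mul]
    | succ j => rw [← inner_conj_symm, h j, map_zero, mul_zero]
  rw [tsum_congr h', tsum_zero, map_zero]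

end Vy

namespace CaseII

open Vy

/-! ### Case II at the next stage is the autocorrelation of `a` (pure KKT) -/

/-- **Case II at the next stage, as a property of the coefficient sequence.**  If `V_y†(x₀ − V_y a) = C'a`
(Lagrange identity (5)), then for every `j ≥ 0`, `⟨x₀ − ℓ'(T)y, T^j ℓ'(T)y⟩ = C'·⟪a, S^j a⟫_{ℓ²}`: whether the
NEXT stage `y' = ℓ'(T)y` is Case II is decided by the autocorrelation of `a` at lags `j ≥ 1` ((9) is the bound
`|·| ≤ C'‖a‖²`; no Case II hypothesis at `y` is used). [cite: Enflo2023, v2 p.3–4, eq. (5), (9); p.12 (Case II)] -/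
theorem inner_next_orbit_eq (T : H →L[ℂ] H) (hT : ‖T‖ < 1) (x₀ y : H) (a : ℓ2) {C : ℝ}
    (hC : ContinuousLinearMap.adjoint (V T hT y) (x₀ - V T hT y a) = (C : ℂ) • a) (j : ℕ) :
    ⟪x₀ - V T hT y a, (T ^ j) (V T hT y a)⟫_ℂ = (C : ℂ) * ⟪a, (S ^ j) a⟫_ℂ := by
  rw [← V_shift_pow]; exact IsMinimal.eq5 hC _

/-- (5) tested against the range of `V_y`, in displacement form: under exact Case II at `y` and
`⟨x₀ − y, y⟩ = εθ`, `⟨ℓ'(T)y − y, V_y r⟩ = r₀εθ − C'⟪a, r⟫` for every `r ∈ ℓ²`. [cite: Enflo2023, v2 p.3, eq. (5); p.12 (Case II)] -/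
theorem inner_displacement_V (T : H →L[ℂ] H) (hT : ‖T‖ < 1) (x₀ y : H) (et : ℝ) (a : ℓ2) {C : ℝ}
    (ht : ⟪x₀ - y, y⟫_ℂ = et) (hII : ∀ j, 1 ≤ j → ⟪x₀ - y, (T ^ j) y⟫_ℂ = 0)
    (hC : ContinuousLinearMap.adjoint (V T hT y) (x₀ - V T hT y a) = (C : ℂ) • a) (r : ℓ2) :
    ⟪V T hT y a - y, V T hT y r⟫_ℂ = r 0 * et - C * ⟪a, r⟫_ℂ := by
  have h1 : V T hT y a - y = (x₀ - y) - (x₀ - V T hT y a) := by abel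
  rw [h1, inner_sub_left, inner_sub_V_of_caseII_exact T hT x₀ y et r ht hII, IsMinimal.eq5 hC r]

/-! ### The setting of (26) with `εθ > 0` -/

omit [CompleteSpace H] in
/-- Setting of (26) from `‖x₀‖ = 1`, `⟨x₀ − y, y⟩ = εθ > 0`: `‖y‖ ≤ 1`, `y ≠ 0`, `‖x₀ − y‖ < 1`, the radius
`‖x₀ − (1+δ)y‖ ≤ ‖x₀ − y‖ < ‖x₀‖`. [cite: Enflo2023, v2 p.4, eq. (8), (10); p.13, eq. (26)] -/
lemma setting_pos (x₀ y : H) (et : ℝ) (h0 : ‖x₀‖ = 1) (ht : ⟪x₀ - y, y⟫_ℂ = et) (het : 0 < et) :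
    (⟪x₀ - y, y⟫_ℂ).re = et ∧ ‖y‖ ≤ 1 ∧ 0 < ‖y‖ ∧ ‖y‖ ^ 2 = 1 - ‖x₀ - y‖ ^ 2 - 2 * et ∧
      ‖x₀ - ((1 + et / 10 : ℝ) : ℂ) • y‖ ≤ ‖x₀ - y‖ ∧ ‖x₀ - ((1 + et / 10 : ℝ) : ℂ) • y‖ < ‖x₀‖ := by
  have hre : (⟪x₀ - y, y⟫_ℂ).re = et := by rw [ht, Complex.ofReal_re]
  have hy1 : ‖y‖ ≤ 1 := norm_move_le_one x₀ y h0 (by rw [hre]; exact het.le)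
  have hysq : ‖y‖ ^ 2 = 1 - ‖x₀ - y‖ ^ 2 - 2 * et := by rw [norm_sq_move x₀ y h0, hre]
  have hy0 : 0 < ‖y‖ := by
    refine norm_pos_iff.2 fun hy => ?_
    rw [hy, inner_zero_right] at ht
    have := congrArg Complex.re ht
    rw [Complex.zero_re, Complex.ofReal_re] at this
    linarith
  have hd1 : ‖x₀ - y‖ < 1 := by
    refine not_le.1 fun hge => ?_
    linarith [sq_nonneg ‖y‖, mul_le_mul hge hge zero_le_one (norm_nonneg (x₀ - y))]
  have hrad : ‖x₀ - ((1 + et / 10 : ℝ) : ℂ) • y‖ ≤ ‖x₀ - y‖ :=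
    radius_le_norm_sub x₀ y et hre (by linarith [pow_le_one₀ (n := 2) (norm_nonneg y) hy1])
  exact ⟨hre, hy1, hy0, hysq, hrad, by rw [h0]; linarith⟩

/-! ### Rigidity: Case II at `y` and at `y' = ℓ'(T)y` forces `ℓ'(T) = a₀ I` -/

/-- **Rigidity of two consecutive exact Case II stages (the tail vanishes).**  Let `‖T‖ < 1` with `‖T‖² ≤ 1/2`,
`‖x₀‖ = 1`, `⟨x₀ − y, y⟩ = εθ > 0`, Case II at `y` EXACTLY (`⟨x₀ − y, T^j y⟩ = 0`, `j ≥ 1`), `a` THE minimal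
solution of (26) (radius `‖x₀ − (1+δ)y‖`, `δ = εθ/10`) and `y' := ℓ'(T)y = V_y a`.  If Case II holds EXACTLY at
`y'` as well (`⟨x₀ − y', T^j y'⟩ = 0`, `j ≥ 1`), then `L a = 0`: all coefficients `a_j`, `j ≥ 1`, vanish and
`ℓ'(T) = a₀ I`.  (The `10⁻²⁰` of the text is not needed; `‖T‖² ≤ 1/2` suffices.) [cite: Enflo2023, v2 p.12 (Case II); p.13, eq. (26), tex L429, L444–L446] -/
theorem L_eq_zero_of_consecutive_caseII (T : H →L[ℂ] H) (hT1 : ‖T‖ < 1) (hT2 : ‖T‖ ^ 2 ≤ 1 / 2)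
    (x₀ y : H) (et : ℝ) (a : ℓ2) (h0 : ‖x₀‖ = 1) (ht : ⟪x₀ - y, y⟫_ℂ = et) (het : 0 < et)
    (hII : ∀ j, 1 ≤ j → ⟪x₀ - y, (T ^ j) y⟫_ℂ = 0)
    (hmin : IsMinimal (V T hT1 y) x₀ ‖x₀ - ((1 + et / 10 : ℝ) : ℂ) • y‖ a)
    (hII' : ∀ j, 1 ≤ j → ⟪x₀ - V T hT1 y a, (T ^ j) (V T hT1 y a)⟫_ℂ = 0) :
    L a = 0 := by
  obtain ⟨hre, hy1, hy0, -, -, hrad1⟩ := setting_pos x₀ y et h0 ht het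
  have hY1 : ‖y‖ ^ 2 ≤ 1 := pow_le_one₀ (norm_nonneg y) hy1
  have ha0 : a ≠ 0 := hmin.ne_zero hrad1
  obtain ⟨C, hC0, hC⟩ := hmin.kkt ha0
  have hact : ‖x₀ - V T hT1 y a‖ = ‖x₀ - ((1 + et / 10 : ℝ) : ℂ) • y‖ := hmin.norm_sub_eq hrad1
  have hna : ‖a‖ ≤ 1 + et / 10 := norm_minimal_le_of_smul_feasible T hT1 (by linarith) hmin le_rfl
  have hu : (a 0).re ≤ 1 + et / 10 :=
    le_trans (le_trans (le_abs_self _) (Complex.abs_re_le_norm _))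
      (le_trans (lp.norm_apply_le_norm (by norm_num) a 0) hna)
  -- the displacement `w` and the tail `w₁ = T V_y(La) = V_y(S(La))`
  set w : H := V T hT1 y a - y with hw_def
  set w₁ : H := V T hT1 y (S (L a)) with hw₁_def
  have hwle : ‖w‖ ≤ et / 10 * ‖y‖ := (norm_displacement_le T hT1 x₀ y et a ht het.le hII hact hu).1
  have hhead : C * (a 0).re = et - (⟪y, w⟫_ℂ).re := mul_re_head_eq_sub T hT1 x₀ y et a hre hC
  have hyw : (⟪y, w⟫_ℂ).re ≤ ‖y‖ * ‖w‖ :=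
    le_trans (le_trans (le_abs_self _) (Complex.abs_re_le_norm _)) (norm_inner_le_norm y w)
  have hCu : et * (1 - ‖y‖ ^ 2 / 10) ≤ C * (a 0).re := by
    have h2 : ‖y‖ * ‖w‖ ≤ ‖y‖ * (et / 10 * ‖y‖) := mul_le_mul_of_nonneg_left hwle (norm_nonneg y)
    rw [hhead]; linarith
  have hw₁T : w₁ = T (V T hT1 y (L a)) := V_shift T hT1 y (L a)
  have hVa : V T hT1 y a = a 0 • y + w₁ := by rw [hw₁T]; exact V_decomp T hT1 y a
  have hbase : V T hT1 y a = y + w := by rw [hw_def]; abel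
  have hw_eq : w = (a 0 - 1) • y + w₁ := by rw [hw_def, hVa, sub_smul, one_smul]; abel
  -- (I) `⟪w, w₁⟫ = −C‖La‖²`
  have hI : ⟪w, w₁⟫_ℂ = -((C * ‖L a‖ ^ 2 : ℝ) : ℂ) := by
    rw [hw_def, hw₁_def, inner_displacement_V T hT1 x₀ y et a ht hII hC (S (L a)), S_apply_zero, inner_S_L]
    push_cast; ring
  -- (II) Case II at `y'`, tested against `V_{y'}(S(La)) = Σ_{j≥1} a_j T^j y'`
  have het' : ⟪x₀ - V T hT1 y a, V T hT1 y a⟫_ℂ = ((C * ‖a‖ ^ 2 : ℝ) : ℂ) := IsMinimal.eq6 hC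
  have hIIa : ⟪x₀ - V T hT1 y a, V T hT1 (V T hT1 y a) (S (L a))⟫_ℂ = 0 := by
    rw [inner_sub_V_of_caseII_exact T hT1 x₀ (V T hT1 y a) (C * ‖a‖ ^ 2) (S (L a)) het' hII',
      S_apply_zero, zero_mul]
  have hexp : V T hT1 (y + w) (S (L a)) = w₁ + T (V T hT1 w (L a)) := by
    rw [V_add_vec, V_shift T hT1 w (L a)]
  have hsub : x₀ - (y + w) = (x₀ - y) - w := by abel
  have horth1 : ⟪x₀ - y, w₁⟫_ℂ = 0 := by
    rw [hw₁_def, inner_sub_V_of_caseII_exact T hT1 x₀ y et (S (L a)) ht hII, S_apply_zero, zero_mul]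
  have horbit : ∀ j : ℕ, ⟪x₀ - y, (T ^ (j + 1)) w⟫_ℂ = 0 := by
    intro j
    rw [hw_def, map_sub, inner_sub_right, ← V_shift_pow T hT1 y (j + 1) a,
      inner_sub_V_of_caseII_exact T hT1 x₀ y et ((S ^ (j + 1)) a) ht hII, S_pow_succ_apply_zero, zero_mul,
      hII (j + 1) (by omega), sub_zero]
  have horth2 : ⟪x₀ - y, T (V T hT1 w (L a))⟫_ℂ = 0 := inner_T_V_eq_zero T hT1 (x₀ - y) w horbit (L a)
  have hIIc : ⟪w, T (V T hT1 w (L a))⟫_ℂ = ((C * ‖L a‖ ^ 2 : ℝ) : ℂ) := by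
    have h := hIIa
    rw [hbase, hexp, hsub, inner_sub_left, inner_add_right, inner_add_right, horth1, horth2, hI] at h
    linear_combination -h
  -- (III) split `V_w = (a₀ − 1)V_y + V_{w₁}`
  have hVw : V T hT1 w (L a) = (a 0 - 1) • V T hT1 y (L a) + V T hT1 w₁ (L a) := by
    rw [hw_eq, V_add_vec, V_smul_vec]
  have hTVw : T (V T hT1 w (L a)) = (a 0 - 1) • w₁ + T (V T hT1 w₁ (L a)) := by
    rw [hVw, map_add, map_smul, ← hw₁T]
  have hZ : ⟪w, T (V T hT1 w₁ (L a))⟫_ℂ = ((C * ‖L a‖ ^ 2 : ℝ) : ℂ) * a 0 := by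
    have h := hIIc
    rw [hTVw, inner_add_right, inner_smul_right, hI] at h
    linear_combination h
  -- (IV) norms: `|Z| ≤ ‖w‖·‖T‖²(1−‖T‖²)⁻¹‖y‖·‖La‖²` versus `|Z| ≥ C·Re a₀·‖La‖²`
  have h1T : 0 ≤ 1 / (1 - ‖T‖ ^ 2) := div_nonneg zero_le_one (by linarith)
  have hs2 : Real.sqrt (1 / (1 - ‖T‖ ^ 2)) ^ 2 = 1 / (1 - ‖T‖ ^ 2) := Real.sq_sqrt h1T
  have hw₁le : ‖w₁‖ ≤ ‖T‖ * (‖y‖ * Real.sqrt (1 / (1 - ‖T‖ ^ 2))) * ‖L a‖ := by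
    have h := norm_V_sub_head_le T hT1 y a
    rwa [hVa, add_sub_cancel_left] at h
  have hZle : ‖⟪w, T (V T hT1 w₁ (L a))⟫_ℂ‖
      ≤ ‖w‖ * (‖T‖ * (‖w₁‖ * Real.sqrt (1 / (1 - ‖T‖ ^ 2)) * ‖L a‖)) := by
    calc ‖⟪w, T (V T hT1 w₁ (L a))⟫_ℂ‖ ≤ ‖w‖ * ‖T (V T hT1 w₁ (L a))‖ := norm_inner_le_norm _ _
      _ ≤ ‖w‖ * (‖T‖ * ‖V T hT1 w₁ (L a)‖) := by gcongr; exact T.le_opNorm _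
      _ ≤ ‖w‖ * (‖T‖ * (‖w₁‖ * Real.sqrt (1 / (1 - ‖T‖ ^ 2)) * ‖L a‖)) := by
          gcongr; exact (V T hT1 w₁).le_of_opNorm_le (norm_V_le T hT1 w₁) (L a)
  have hZge : C * (a 0).re * ‖L a‖ ^ 2 ≤ ‖⟪w, T (V T hT1 w₁ (L a))⟫_ℂ‖ := by
    rw [hZ, norm_mul, Complex.norm_real, Real.norm_of_nonneg (mul_nonneg hC0 (sq_nonneg _))]
    have hre0 : (a 0).re ≤ ‖a 0‖ := le_trans (le_abs_self _) (Complex.abs_re_le_norm _)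
    have := mul_le_mul_of_nonneg_left hre0 (mul_nonneg hC0 (sq_nonneg ‖L a‖))
    linarith [this]
  have hchain : C * (a 0).re * ‖L a‖ ^ 2
      ≤ (et / 10 * ‖y‖) * (‖T‖ ^ 2 * (1 / (1 - ‖T‖ ^ 2)) * ‖y‖) * ‖L a‖ ^ 2 := by
    calc C * (a 0).re * ‖L a‖ ^ 2 ≤ ‖w‖ * (‖T‖ * (‖w₁‖ * Real.sqrt (1 / (1 - ‖T‖ ^ 2)) * ‖L a‖)) :=
          le_trans hZge hZle
      _ ≤ (et / 10 * ‖y‖) * (‖T‖ * ((‖T‖ * (‖y‖ * Real.sqrt (1 / (1 - ‖T‖ ^ 2))) * ‖L a‖)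
            * Real.sqrt (1 / (1 - ‖T‖ ^ 2)) * ‖L a‖)) := by
          have hw0 : 0 ≤ et / 10 * ‖y‖ := by positivity
          gcongr
      _ = (et / 10 * ‖y‖) * (‖T‖ ^ 2 * Real.sqrt (1 / (1 - ‖T‖ ^ 2)) ^ 2 * ‖y‖) * ‖L a‖ ^ 2 := by ring
      _ = (et / 10 * ‖y‖) * (‖T‖ ^ 2 * (1 / (1 - ‖T‖ ^ 2)) * ‖y‖) * ‖L a‖ ^ 2 := by rw [hs2]
  have hfrac : ‖T‖ ^ 2 * (1 / (1 - ‖T‖ ^ 2)) ≤ 1 := by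
    rw [mul_one_div, div_le_one (by linarith)]; linarith
  -- conclusion: `εθ·‖La‖²·(1 − ‖y‖²/5) ≤ 0`
  have hLa : ‖L a‖ ^ 2 ≤ 0 := by
    have h1 : et * (1 - ‖y‖ ^ 2 / 10) * ‖L a‖ ^ 2 ≤ C * (a 0).re * ‖L a‖ ^ 2 :=
      mul_le_mul_of_nonneg_right hCu (sq_nonneg _)
    have h2 : 0 ≤ (et / 10 * ‖y‖ ^ 2 * ‖L a‖ ^ 2) * (1 - ‖T‖ ^ 2 * (1 / (1 - ‖T‖ ^ 2))) :=
      mul_nonneg (by positivity) (sub_nonneg.2 hfrac)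
    have h3 : et * (1 - ‖y‖ ^ 2 / 5) * ‖L a‖ ^ 2 ≤ 0 := by linarith [h1, h2, hchain]
    have h4 : 0 < et * (1 - ‖y‖ ^ 2 / 5) := mul_pos het (by linarith)
    exact not_lt.1 fun hc => by linarith [mul_pos h4 hc]
  have hLa0 : ‖L a‖ ^ 2 = 0 := le_antisymm hLa (sq_nonneg _)
  exact norm_eq_zero.1 (pow_eq_zero_iff two_ne_zero |>.1 hLa0)

/-- **What two consecutive exact Case II stages look like.**  Under the hypotheses of
`L_eq_zero_of_consecutive_caseII`: `L a = 0`, the head coefficient is EXACTLY `a₀ = 1 + δ` (`δ = εθ/10`), the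
move is the pure scaling `ℓ'(T)y = (1+δ)y`, the orbit is orthogonal to `y` (`⟨T^j y, y⟩ = 0`, `j ≥ 1`), and the
new `εθ` is `(εθ)' = (1+δ)(1 − ‖y‖²/10)·εθ` — the text's Remark ("`ℓ_{1δ}(T)` will just be near to
`ℓ(T) + 2δI`", tex L444) made exact. [cite: Enflo2023, v2 p.13, eq. (26), tex L429, L444–L446] -/
theorem consecutive_caseII_rigidity (T : H →L[ℂ] H) (hT1 : ‖T‖ < 1) (hT2 : ‖T‖ ^ 2 ≤ 1 / 2)
    (x₀ y : H) (et : ℝ) (a : ℓ2) (h0 : ‖x₀‖ = 1) (ht : ⟪x₀ - y, y⟫_ℂ = et) (het : 0 < et)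
    (hII : ∀ j, 1 ≤ j → ⟪x₀ - y, (T ^ j) y⟫_ℂ = 0)
    (hmin : IsMinimal (V T hT1 y) x₀ ‖x₀ - ((1 + et / 10 : ℝ) : ℂ) • y‖ a)
    (hII' : ∀ j, 1 ≤ j → ⟪x₀ - V T hT1 y a, (T ^ j) (V T hT1 y a)⟫_ℂ = 0) :
    L a = 0 ∧ a 0 = ((1 + et / 10 : ℝ) : ℂ) ∧ V T hT1 y a = ((1 + et / 10 : ℝ) : ℂ) • y ∧
      (∀ j, 1 ≤ j → ⟪(T ^ j) y, y⟫_ℂ = 0) ∧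
      (⟪x₀ - V T hT1 y a, V T hT1 y a⟫_ℂ).re = (1 + et / 10) * (1 - ‖y‖ ^ 2 / 10) * et := by
  have hL := L_eq_zero_of_consecutive_caseII T hT1 hT2 x₀ y et a h0 ht het hII hmin hII'
  obtain ⟨hre, hy1, hy0, -, -, hrad1⟩ := setting_pos x₀ y et h0 ht het
  have hY1 : ‖y‖ ^ 2 ≤ 1 := pow_le_one₀ (norm_nonneg y) hy1
  have hY0 : 0 < ‖y‖ ^ 2 := by positivity
  have ha0 : a ≠ 0 := hmin.ne_zero hrad1
  obtain ⟨C, hC0, hC⟩ := hmin.kkt ha0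
  have hact : ‖x₀ - V T hT1 y a‖ = ‖x₀ - ((1 + et / 10 : ℝ) : ℂ) • y‖ := hmin.norm_sub_eq hrad1
  have hna : ‖a‖ ≤ 1 + et / 10 := norm_minimal_le_of_smul_feasible T hT1 (by linarith) hmin le_rfl
  have hu : (a 0).re ≤ 1 + et / 10 :=
    le_trans (le_trans (le_abs_self _) (Complex.abs_re_le_norm _))
      (le_trans (lp.norm_apply_le_norm (by norm_num) a 0) hna)
  -- the move is `a₀ y`
  have hVa : V T hT1 y a = a 0 • y := by
    rw [V_decomp T hT1 y a, hL, map_zero, map_zero, add_zero]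
  -- `a₀ = 1 + δ` from the displacement identity `‖ℓ'(T)y − y‖² = δ²‖y‖² − 2εθ((1+δ) − Re a₀)`
  have hdisp := norm_sq_displacement_eq T hT1 x₀ y et a ht hII hact
  have hnw : ‖V T hT1 y a - y‖ ^ 2 = (((a 0).re - 1) ^ 2 + (a 0).im ^ 2) * ‖y‖ ^ 2 := by
    have e : V T hT1 y a - y = (a 0 - 1) • y := by rw [hVa, sub_smul, one_smul]
    rw [e, norm_smul, mul_pow, ← Complex.normSq_eq_norm_sq, Complex.normSq_apply]
    simp only [Complex.sub_re, Complex.one_re, Complex.sub_im, Complex.one_im, sub_zero]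
    ring
  have hid : (1 + et / 10 - (a 0).re) * (2 * et - 2 * (et / 10) * ‖y‖ ^ 2 + (1 + et / 10 - (a 0).re) * ‖y‖ ^ 2)
      + (a 0).im ^ 2 * ‖y‖ ^ 2 = 0 := by
    rw [hnw] at hdisp; linear_combination hdisp
  have hβ0 : 0 ≤ 1 + et / 10 - (a 0).re := by linarith
  have hpos : 0 < 2 * et - 2 * (et / 10) * ‖y‖ ^ 2 + (1 + et / 10 - (a 0).re) * ‖y‖ ^ 2 := by
    linarith [mul_nonneg hβ0 hY0.le, mul_le_mul_of_nonneg_left hY1 het.le]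
  have hv2 : 0 ≤ (a 0).im ^ 2 * ‖y‖ ^ 2 := by positivity
  have hβ : 1 + et / 10 - (a 0).re = 0 := by
    have hle : (1 + et / 10 - (a 0).re) * (2 * et - 2 * (et / 10) * ‖y‖ ^ 2
        + (1 + et / 10 - (a 0).re) * ‖y‖ ^ 2) ≤ 0 := by linarith
    by_contra hne
    have hpos' : 0 < 1 + et / 10 - (a 0).re := lt_of_le_of_ne hβ0 (Ne.symm hne)
    linarith [mul_pos hpos' hpos]
  have hure : (a 0).re = 1 + et / 10 := by linarith
  have huim : (a 0).im = 0 := by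
    rw [hβ, zero_mul, zero_add] at hid
    have : (a 0).im ^ 2 = 0 := by
      rcases mul_eq_zero.1 hid with h | h
      · exact h
      · exact absurd h hY0.ne'
    exact pow_eq_zero_iff two_ne_zero |>.1 this
  have ha0eq : a 0 = ((1 + et / 10 : ℝ) : ℂ) := by
    apply Complex.ext
    · rw [hure, Complex.ofReal_re]
    · rw [huim, Complex.ofReal_im]
  have hVac : V T hT1 y a = ((1 + et / 10 : ℝ) : ℂ) • y := by rw [hVa, ha0eq]
  -- orbit orthogonal to `y`: (5) at `j ≥ 1` with `a_j = 0`
  have hyy : ∀ j, 1 ≤ j → ⟪(T ^ j) y, y⟫_ℂ = 0 := by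
    intro j hj
    obtain ⟨k, rfl⟩ : ∃ k, j = k + 1 := ⟨j - 1, by omega⟩
    have hk := kkt_coord T hT1 y x₀ a hC (k + 1)
    have hak : a (k + 1) = 0 := by
      have := L_apply a k
      rw [hL] at this
      simpa using this.symm
    have hsplit : x₀ - V T hT1 y a = (x₀ - y) - ((et / 10 : ℝ) : ℂ) • y := by
      rw [hVac]; push_cast; rw [add_smul, one_smul]; abel
    rw [hak, mul_zero, hsplit, inner_sub_right, inner_smul_right, ← inner_conj_symm, hII (k + 1) hj,
      map_zero, zero_sub, neg_eq_zero, mul_eq_zero] at hk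
    rcases hk with h | h
    · exfalso
      have : (et / 10 : ℝ) = 0 := by exact_mod_cast h
      linarith
    · exact h
  -- the new `εθ`
  have hx0y : ⟪x₀, y⟫_ℂ = (et : ℂ) + ((‖y‖ ^ 2 : ℝ) : ℂ) := by
    have h := ht
    rw [inner_sub_left, inner_self_eq_coe_norm_sq] at h
    linear_combination h
  have hprod : ⟪x₀ - V T hT1 y a, V T hT1 y a⟫_ℂ
      = (((1 + et / 10) * (1 - ‖y‖ ^ 2 / 10) * et : ℝ) : ℂ) := by
    rw [hVac, inner_smul_right, inner_sub_left, inner_smul_left, hx0y, inner_self_eq_coe_norm_sq,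
      Complex.conj_ofReal]
    push_cast; ring
  refine ⟨hL, ha0eq, hVac, hyy, ?_⟩
  rw [hprod, Complex.ofReal_re]

/-! ### Consequences for the sentence at tex L429 -/

omit [CompleteSpace H] in
/-- `‖T‖ ≤ 10⁻²⁰` implies `‖T‖² ≤ 1/2` (the only smallness of `T` the rigidity uses). [folklore] -/
lemma normT_sq_le_half (T : H →L[ℂ] H) (hT : ‖T‖ ≤ 1 / 10 ^ 20) : ‖T‖ ^ 2 ≤ 1 / 2 :=
  calc ‖T‖ ^ 2 = ‖T‖ * ‖T‖ := sq ‖T‖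
    _ ≤ 1 / 10 ^ 20 * (1 / 10 ^ 20) := mul_le_mul hT hT (norm_nonneg _) (by norm_num)
    _ ≤ 1 / 2 := by norm_num

omit [CompleteSpace H] in
/-- Window arithmetic: `‖x₀‖ = 1`, `‖x₀ − y‖ ≤ 0.7`, `0 < εθ ≤ 10⁻⁴` give `‖y‖² ≥ 0.5098` and
`(1+δ)(1 − ‖y‖²/10) ≤ 0.9491 < 1 − 1/20`. [cite: Enflo2023, v2 p.4, eq. (10); p.13 ("diminished by a factor (1 − 1/20)")] -/
lemma scaling_factor_le (x₀ y : H) (et : ℝ) (h0 : ‖x₀‖ = 1) (ht : ⟪x₀ - y, y⟫_ℂ = et) (het : 0 < et)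
    (het1 : et ≤ 1 / 10 ^ 4) (hd : ‖x₀ - y‖ ≤ 0.7) :
    0.5098 ≤ ‖y‖ ^ 2 ∧ (1 + et / 10) * (1 - ‖y‖ ^ 2 / 10) ≤ 0.9491 := by
  obtain ⟨-, -, -, hysq, -, -⟩ := setting_pos x₀ y et h0 ht het
  have hd2 : ‖x₀ - y‖ ^ 2 ≤ 0.49 := by
    have := mul_le_mul hd hd (norm_nonneg _) (by norm_num)
    linarith [sq_nonneg ‖x₀ - y‖]
  have hY : 0.5098 ≤ ‖y‖ ^ 2 := by rw [hysq]; linarith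
  exact ⟨hY, by linarith [mul_nonneg het.le (sq_nonneg ‖y‖)]⟩

/-- **The factor holds at every Case II stage that is followed by a Case II stage** (exact reading).  In the
text's setting (`‖T‖ ≤ 10⁻²⁰`, `‖x₀‖ = 1`, `‖x₀ − y‖ ≤ 0.7`, `0 < εθ ≤ 10⁻⁴`, `⟨x₀ − y, y⟩ = εθ`), if Case II
holds exactly at `y` and at `y' = ℓ'(T)y` (THE minimal solution of (26)), then
`(εθ)' ≤ 0.9491·εθ ≤ (1 − 1/20)·εθ`.  So on the branch "Case II happens every time" the contraction claimed at
tex L429 is TRUE for the minimiser — although (27) (`CaseII.eq27_false_for_minimal`) and the single-stage factor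
(`CaseII.factor_false_for_minimal`) are false. [cite: Enflo2023, v2 p.13, tex L421–L431 ("diminished by a factor (1 − 1/20)")] -/
theorem factor_of_consecutive_caseII (T : H →L[ℂ] H) (hT1 : ‖T‖ < 1) (hT : ‖T‖ ≤ 1 / 10 ^ 20)
    (x₀ y : H) (et : ℝ) (a : ℓ2) (h0 : ‖x₀‖ = 1) (ht : ⟪x₀ - y, y⟫_ℂ = et) (het : 0 < et)
    (het1 : et ≤ 1 / 10 ^ 4) (hd : ‖x₀ - y‖ ≤ 0.7)
    (hII : ∀ j, 1 ≤ j → ⟪x₀ - y, (T ^ j) y⟫_ℂ = 0)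
    (hmin : IsMinimal (V T hT1 y) x₀ ‖x₀ - ((1 + et / 10 : ℝ) : ℂ) • y‖ a)
    (hII' : ∀ j, 1 ≤ j → ⟪x₀ - V T hT1 y a, (T ^ j) (V T hT1 y a)⟫_ℂ = 0) :
    (⟪x₀ - V T hT1 y a, V T hT1 y a⟫_ℂ).re ≤ 0.9491 * et ∧
      (⟪x₀ - V T hT1 y a, V T hT1 y a⟫_ℂ).re ≤ (1 - 1 / 20) * et ∧
      0 < (⟪x₀ - V T hT1 y a, V T hT1 y a⟫_ℂ).re := by
  have hT2 : ‖T‖ ^ 2 ≤ 1 / 2 := normT_sq_le_half T hT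
  obtain ⟨-, -, -, -, hsucc⟩ := consecutive_caseII_rigidity T hT1 hT2 x₀ y et a h0 ht het hII hmin hII'
  obtain ⟨hY, hfac⟩ := scaling_factor_le x₀ y et h0 ht het het1 hd
  obtain ⟨-, hy1, -, -, -, -⟩ := setting_pos x₀ y et h0 ht het
  have hY1 : ‖y‖ ^ 2 ≤ 1 := pow_le_one₀ (norm_nonneg y) hy1
  rw [hsucc]
  have hm := mul_le_mul_of_nonneg_right hfac het.le
  refine ⟨by linarith, by linarith, ?_⟩
  exact mul_pos (mul_pos (by linarith) (by linarith)) het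

/-- **Where the factor fails, the next stage is not Case II** (exact reading; contrapositive of
`factor_of_consecutive_caseII`).  In particular the aligned deep-regime failure of `CaseII.factor_false_for_minimal`
/ `CaseII.FactorModel` is a ONE-STAGE phenomenon: its successor `y' = ℓ'(T)y` has `⟨x₀ − y', T^j y'⟩ ≠ 0` for
some `j ≥ 1` (with `CaseII.inner_next_orbit_eq`: `C'⟪a, S^j a⟫ ≠ 0`). [cite: Enflo2023, v2 p.12 (Case I / Case II); p.13, tex L429] -/
theorem next_not_caseII_of_factor_fails (T : H →L[ℂ] H) (hT1 : ‖T‖ < 1) (hT : ‖T‖ ≤ 1 / 10 ^ 20)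
    (x₀ y : H) (et : ℝ) (a : ℓ2) (h0 : ‖x₀‖ = 1) (ht : ⟪x₀ - y, y⟫_ℂ = et) (het : 0 < et)
    (het1 : et ≤ 1 / 10 ^ 4) (hd : ‖x₀ - y‖ ≤ 0.7)
    (hII : ∀ j, 1 ≤ j → ⟪x₀ - y, (T ^ j) y⟫_ℂ = 0)
    (hmin : IsMinimal (V T hT1 y) x₀ ‖x₀ - ((1 + et / 10 : ℝ) : ℂ) • y‖ a)
    (hfail : (1 - 1 / 20) * et < (⟪x₀ - V T hT1 y a, V T hT1 y a⟫_ℂ).re) :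
    ∃ j, 1 ≤ j ∧ ⟪x₀ - V T hT1 y a, (T ^ j) (V T hT1 y a)⟫_ℂ ≠ 0 := by
  by_contra h
  have h' : ∀ j, 1 ≤ j → ⟪x₀ - V T hT1 y a, (T ^ j) (V T hT1 y a)⟫_ℂ = 0 :=
    fun j hj => Classical.by_contradiction fun hne => h ⟨j, hj, hne⟩
  have := (factor_of_consecutive_caseII T hT1 hT x₀ y et a h0 ht het het1 hd hII hmin h').2.1
  linarith

/-- **Two consecutive exact Case II stages already give the invariant subspace.**  In the text's setting with the
window `0.3 ≤ ‖x₀ − y‖ ≤ 0.7` and `0 < εθ ≤ 10⁻⁴`: if Case II holds exactly at `y` and at `y' = ℓ'(T)y`, then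
`y` is non-cyclic — `x₀ − (1 + εθ/‖y‖²)y ≠ 0` is orthogonal to `T^j y` for every `j ≥ 0` — so `T` has a
non-trivial closed invariant subspace.  On the branch "Case II happens every time" (tex L429) this applies at the
first two stages: the conclusion "we obtain … a non-cyclic vector" holds WITHOUT the convergence argument (and
the run is the scaling ray `y_n = c_n y₀`, `consecutive_caseII_rigidity`). [cite: Enflo2023, v2 p.13, tex L429 ("if Case II happens every time we obtain convergence to a non-cyclic vector")] -/
theorem hasNontrivialClosedInvariantSubspace_of_consecutive_caseII (T : H →L[ℂ] H) (hT1 : ‖T‖ < 1)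
    (hT : ‖T‖ ≤ 1 / 10 ^ 20) (x₀ y : H) (et : ℝ) (a : ℓ2) (h0 : ‖x₀‖ = 1) (ht : ⟪x₀ - y, y⟫_ℂ = et)
    (het : 0 < et) (het1 : et ≤ 1 / 10 ^ 4) (hwin : 0.3 ≤ ‖x₀ - y‖ ∧ ‖x₀ - y‖ ≤ 0.7)
    (hII : ∀ j, 1 ≤ j → ⟪x₀ - y, (T ^ j) y⟫_ℂ = 0)
    (hmin : IsMinimal (V T hT1 y) x₀ ‖x₀ - ((1 + et / 10 : ℝ) : ℂ) • y‖ a)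
    (hII' : ∀ j, 1 ≤ j → ⟪x₀ - V T hT1 y a, (T ^ j) (V T hT1 y a)⟫_ℂ = 0) :
    HasNontrivialClosedInvariantSubspace T := by
  have hT2 : ‖T‖ ^ 2 ≤ 1 / 2 := normT_sq_le_half T hT
  obtain ⟨-, -, -, hyy, -⟩ := consecutive_caseII_rigidity T hT1 hT2 x₀ y et a h0 ht het hII hmin hII'
  obtain ⟨-, hy1, hy0, hysq, -, -⟩ := setting_pos x₀ y et h0 ht het
  obtain ⟨hY, -⟩ := scaling_factor_le x₀ y et h0 ht het het1 hwin.2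
  have hYne : (‖y‖ ^ 2 : ℝ) ≠ 0 := (pow_pos hy0 2).ne'
  have hyne : y ≠ 0 := norm_pos_iff.1 hy0
  -- the vector `x₀ − (1 + εθ/‖y‖²) y`
  set c : ℝ := 1 + et / ‖y‖ ^ 2 with hc
  have hx0y : ⟪x₀, y⟫_ℂ = (et : ℂ) + ((‖y‖ ^ 2 : ℝ) : ℂ) := by
    have h := ht
    rw [inner_sub_left, inner_self_eq_coe_norm_sq] at h
    linear_combination h
  have horth : ∀ j : ℕ, ⟪x₀ - (c : ℂ) • y, (T ^ j) y⟫_ℂ = 0 := by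
    intro j
    rw [inner_sub_left, inner_smul_left, Complex.conj_ofReal]
    rcases Nat.eq_zero_or_pos j with hj | hj
    · subst hj
      rw [pow_zero, one_apply_eq_self, hx0y, inner_self_eq_coe_norm_sq, hc]
      have : ((1 + et / ‖y‖ ^ 2 : ℝ) : ℂ) * ((‖y‖ ^ 2 : ℝ) : ℂ) = (et : ℂ) + ((‖y‖ ^ 2 : ℝ) : ℂ) := by
        rw [← Complex.ofReal_mul, ← Complex.ofReal_add]
        congr 1
        field_simp
        ring
      rw [this, sub_self]
    · have h1 : ⟪x₀, (T ^ j) y⟫_ℂ = 0 := by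
        have h2 := hII j hj
        rw [inner_sub_left, ← inner_conj_symm y, hyy j hj, map_zero, sub_zero] at h2
        exact h2
      rw [h1, ← inner_conj_symm, hyy j hj, map_zero, mul_zero, sub_zero]
  refine hasNontrivialClosedInvariantSubspace_of_orbit_orthogonal' T hyne ?_ horth
  -- `x₀ − c y ≠ 0`: otherwise `‖x₀ − y‖ = (c − 1)‖y‖ = εθ/‖y‖ ≤ 2·10⁻⁴ < 0.3`
  intro hzero
  have hx : x₀ - y = ((et / ‖y‖ ^ 2 : ℝ) : ℂ) • y := by
    have h1 : x₀ = (c : ℂ) • y := sub_eq_zero.1 hzero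
    rw [h1, hc]; push_cast; rw [add_smul, one_smul]; abel
  have hn : ‖x₀ - y‖ = et / ‖y‖ ^ 2 * ‖y‖ := by
    rw [hx, norm_smul, Complex.norm_real, Real.norm_of_nonneg (by positivity)]
  have hsmall : et / ‖y‖ ^ 2 * ‖y‖ ≤ 2 / 10 ^ 4 := by
    have h1 : et / ‖y‖ ^ 2 ≤ et / 0.5098 := div_le_div_of_nonneg_left het.le (by norm_num) hY
    have h2 : et / ‖y‖ ^ 2 * ‖y‖ ≤ et / 0.5098 * 1 :=
      mul_le_mul h1 hy1 (norm_nonneg y) (by positivity)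
    have h3 : et / 0.5098 ≤ (1 / 10 ^ 4) / 0.5098 := div_le_div_of_nonneg_right het1 (by norm_num)
    have h4 : (1 / 10 ^ 4 : ℝ) / 0.5098 ≤ 2 / 10 ^ 4 := by norm_num
    linarith
  linarith [hwin.1]

/-- The same with `εθ = 0` allowed: then already `x₀ − y ⟂ T^j y` for all `j ≥ 0` (Case II at `y` and
`⟨x₀ − y, y⟩ = 0`), and the window gives `y ≠ 0`, `x₀ − y ≠ 0`. [cite: Enflo2023, v2 p.13, tex L429; p.3 ("if `C' = 0` then `y₀` is non-cyclic")] -/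
theorem hasNontrivialClosedInvariantSubspace_of_consecutive_caseII' (T : H →L[ℂ] H) (hT1 : ‖T‖ < 1)
    (hT : ‖T‖ ≤ 1 / 10 ^ 20) (x₀ y : H) (et : ℝ) (a : ℓ2) (h0 : ‖x₀‖ = 1) (ht : ⟪x₀ - y, y⟫_ℂ = et)
    (het0 : 0 ≤ et) (het1 : et ≤ 1 / 10 ^ 4) (hwin : 0.3 ≤ ‖x₀ - y‖ ∧ ‖x₀ - y‖ ≤ 0.7)
    (hII : ∀ j, 1 ≤ j → ⟪x₀ - y, (T ^ j) y⟫_ℂ = 0)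
    (hmin : IsMinimal (V T hT1 y) x₀ ‖x₀ - ((1 + et / 10 : ℝ) : ℂ) • y‖ a)
    (hII' : ∀ j, 1 ≤ j → ⟪x₀ - V T hT1 y a, (T ^ j) (V T hT1 y a)⟫_ℂ = 0) :
    HasNontrivialClosedInvariantSubspace T := by
  rcases het0.eq_or_lt with h0' | hpos
  · have hy : y ≠ 0 := by
      intro hy
      rw [hy, sub_zero, h0] at hwin
      norm_num at hwin
    have hx : x₀ - y ≠ 0 := by
      intro hx
      rw [hx, norm_zero] at hwin
      norm_num at hwin
    refine hasNontrivialClosedInvariantSubspace_of_orbit_orthogonal' T hy hx fun j => ?_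
    rcases Nat.eq_zero_or_pos j with hj | hj
    · subst hj; rw [pow_zero, one_apply_eq_self, ht, ← h0', Complex.ofReal_zero]
    · exact hII j hj
  · exact hasNontrivialClosedInvariantSubspace_of_consecutive_caseII T hT1 hT x₀ y et a h0 ht hpos het1 hwin
      hII hmin hII'

/-- **Row A26 on the exact-Case-II branch, with NO contraction hypothesis** (compare
`CaseII.hasNontrivialClosedInvariantSubspace_of_contraction_along_runs`, which had to ASSUME the factor).  Let
`‖T‖ ≤ 10⁻²⁰`, `‖x₀‖ = 1`, `y₀` in the window `0.3 ≤ ‖x₀ − y₀‖ ≤ 0.7` with `⟨x₀ − y₀, y₀⟩ = (εθ)₀ ∈ [0, 10⁻⁴]`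
real (as it is for Lemma 2's minimiser, eq. (6)).  If along every iteration of (26) started at `y₀`
(`y_{n+1} = ℓ'_n(T)y_n`, `a_n` minimal — it exists, `CaseII.exists_run`, and is unique, `IsMinimal.unique`) Case II
holds EXACTLY at every stage, then `T` has a non-trivial closed invariant subspace.  Only the stages `n = 0, 1` are
used: the text's "if Case II happens every time we obtain convergence to a non-cyclic vector" (tex L429) is, read
exactly, true and needs neither (27) nor the factor nor convergence. [cite: Enflo2023, v2 p.13, eq. (26) and tex L429] -/
theorem hasNontrivialClosedInvariantSubspace_of_exact_caseII_along_runs (T : H →L[ℂ] H) (hT : ‖T‖ < 1)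
    (hT20 : ‖T‖ ≤ 1 / 10 ^ 20) (x₀ y₀ : H) (hx₀ : ‖x₀‖ = 1) (hwin : 0.3 ≤ ‖x₀ - y₀‖ ∧ ‖x₀ - y₀‖ ≤ 0.7)
    (him : (⟪x₀ - y₀, y₀⟫_ℂ).im = 0) (ht0 : 0 ≤ (⟪x₀ - y₀, y₀⟫_ℂ).re)
    (ht1 : (⟪x₀ - y₀, y₀⟫_ℂ).re ≤ 1 / 10 ^ 4)
    (hII : ∀ (y : ℕ → H) (a : ℕ → ℓ2), y 0 = y₀ →
      (∀ n, IsMinimal (V T hT (y n)) x₀ ‖x₀ - ((1 + (⟪x₀ - y n, y n⟫_ℂ).re / 10 : ℝ) : ℂ) • y n‖ (a n) ∧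
        y (n + 1) = V T hT (y n) (a n)) →
      ∀ n j, 1 ≤ j → ⟪x₀ - y n, (T ^ j) (y n)⟫_ℂ = 0) :
    HasNontrivialClosedInvariantSubspace T := by
  obtain ⟨y, a, hy0, hrun⟩ := exists_run T hT x₀ y₀
  have hc := hII y a hy0 hrun
  subst hy0
  have ht : ⟪x₀ - y 0, y 0⟫_ℂ = ((⟪x₀ - y 0, y 0⟫_ℂ).re : ℂ) :=
    Complex.ext (by rw [Complex.ofReal_re]) (by rw [Complex.ofReal_im, him])
  have h1 : y 1 = V T hT (y 0) (a 0) := (hrun 0).2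
  exact hasNontrivialClosedInvariantSubspace_of_consecutive_caseII' T hT hT20 x₀ (y 0) _ (a 0) hx₀ ht ht0 ht1
    hwin (hc 0) (hrun 0).1 (by rw [← h1]; exact hc 1)

end CaseII

end Literature.Analysis.OperatorTheory.Enflo2023

end
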